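import Summits.ResolutionOfSingularities.ResolutionOfSingularities.Theorems.HilbertSamuelEliminationSigmaMaxModificationsCorridor3SigmaPersistentContactCover
import Literature.AlgebraicGeometry.Resolution.HypersurfacePushforward
import Literature.AlgebraicGeometry.Resolution.BoundaryRestriction
import Literature.AlgebraicGeometry.Resolution.KollarMaxContactPersistence
import Literature.AlgebraicGeometry.Resolution.SncParameterExchange
import Literature.AlgebraicGeometry.Resolution.BlowupSNC
import HarnessLib

/-!
# [OURS · L1 W4.2] σ-LAYER — `Corridor3SigmaPersistentContactCoverSnc`: the «𝓑 ∪ H snc BY INDUCTION OVER MOVES» HALF of the (T-adapt) socket — BASE AND STEP PROVED: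
# (base) a contact chart's hypersurface alone is snc; (step) if 𝓑 ∪ H is snc on the chart and the centre is 𝓑-permissible (snc with 𝓑, regular, inside the
# order-`≥ S₀` locus), then after the blow-up the TRANSPORTED chart's H′ together with the transformed boundary (strict transforms ++ exceptional divisor) is snc again
# (res-L1-w42-plan-1 RULING v3.14-51a (51a-E) «OWNER res-L1-type-o2 g9 … statement-first with the chart step PROVED if routine, following tri-1's l.73913 (B) sketch
# (base 𝓑 = ∅; step … Z regular and n.c. with 𝓑 ((B1)(iii)), Z ⊆ V(H) ⇒ Z n.c. with 𝓑 + H in W ⇒ after the blow-up 𝓑′ + E_Z + H′ snc)»; res-L1-w42-tri-1 TRIAGE v8.13 (P-4)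
# «socket half-typed: persistence ✓ p568042, snc ✗»; seat res-L1-type-o2 g9 = «res-type-067/068 SUCCESSOR», owner of p568042 / p569496;
# `--supports stmt-ResolutionOfSingularities-19249 --as helper`, counted 0)

HONEST FRAMING. OURS packaging; the mathematics is the tree's: a regular order-one hypersurface is snc (`hasSNC_singleton_of_generator`, Kollár 3.80), the parameter
exchange «centre ⊆ hypersurface, centre snc with E, H + E snc ⇒ centre snc with H + E» (`HasSNCWith.cons_of_le`, Kollár 3.104 Step 2.1), snc persists under blow-ups in
snc centres (`HasSNCWith.hasSNC_transform`, Kollár Def. 3.25 / BGMW Def. 3.1.3), the strict transform of a regular order-one hypersurface through the regular centre IS its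
weight-one controlled transform (`IsBlowup.strictTransformIdeal_eq_controlledTransform_of_hypersurface`, Kollár 3.30.2), the contact hypersurface contains the centre
(res-D-pv-060's `le_centre_of_diffContact`, Kollár 3.80 (1)), and the restriction kit (`HasSNCWith.comap_of_isOpenImmersion`, `transformBoundary_morphismRestrict`).
Every `theorem` PROVED; two `def`s (the readings `ContactChart.SncWith`, `ContactCover.SncWith`); no named fact, no axiom, no `instance`. NOTHING here is a statement of
H. Hironaka's manuscript [Hironaka2017] nor of Cutkosky 2009 / Cossart–Jannsen–Saito. AI-typed; AI review weaker than expert review.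

## Contents (namespace `…Theorems.SigmaMaxModificationsCorridor3.Sigma`)

* **`ContactChart.SncWith ch E`** — «𝓑 ∪ H has simple normal crossings on the chart»: `HasSNC (ch.H :: E.map (·.comap ch.U.ι))` (the contact hypersurface as the
  FIRST member of the boundary list restricted to the chart's open subscheme; list order chosen so that the transform law is literal).
* BASE (`𝓑 = ∅`): **`ContactChart.sncWith_nil`** — `ch.SncWith []` on a regular `W` (PROVED: order-one generators + regularity).
* `ContactChart.le_centre` — `H ≤ C|_U` (060's `le_centre_of_diffContact` on the open subscheme).
* `ContactChart.hasSNCWith_cons` — THE LIFT (tri-1 (B), Kollár 3.104 Step 2.1): `ch.SncWith E` ∧ `HasSNCWith E C` (𝓑-permissible centre) ⇒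
  `HasSNCWith (ch.H :: 𝓑|_U) (C|_U)` (PROVED).
* `ContactChart.strictTransformIdeal_H_eq` — `strict transform of H = (τ∣_U)ᶜ(H, 1) =` the transported chart's `H′`.
* **`ContactChart.sncWith_transform`** — THE STEP LAW (PROVED): `ch.SncWith E` ∧ `HasSNCWith E C` ⇒ `(ch.transform …).SncWith (E.map (strictTransformIdeal τ C) ++ [C.comap τ])`
  (the transformed boundary of record, `MarkedIdeal.transform_boundary`); `…_of_hasSNCWith` = the same from the lifted hypothesis directly.
* RESTRICTION (tri-1's ask, Cutkosky Def. 5.4 «E a SNC divisor on V»): `ContactChart.isRegular_subscheme_H` (`V(H) ∩ U` regular), `ContactChart.hasSNC_traces_of_sncWith`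
  (`ch.SncWith E` ⇒ the traces of `𝓑|_U` on `V(H) ∩ U`, members equal to `H` discarded, are snc; `…_of_ne` without the filter) — BGMW 3.9.4 (1), PROVED.
* Cover level: `ContactCover.SncWith`, `ContactCover.sncWith_nil`, `ContactCover.sncWith_transform` (chartwise).

VACUITY SELF-CHECK. The step law has content (its hypothesis `HasSNCWith E C` is the 𝓑-permissibility clause of the run's centres, (B1)(iii); its conclusion is Cutkosky's
Def. 5.4 requirement «E snc with the maximal-contact hypersurface» at the next stage); it is false without `HasSNCWith E C` (a centre tangent to a member breaks snc), and the
base is false on a singular `W` (hence the `Scheme.IsRegular W` binder, present anyway in `ContactChart.transform`).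
-/

noncomputable section

set_option linter.dupNamespace false -- mandated namespace of this single-conjunct summit

open CategoryTheory AlgebraicGeometry TopologicalSpace IsLocalRing
open Literature.AlgebraicGeometry.Resolution
open Summit.ResolutionOfSingularities.ResolutionOfSingularities.Theorems.SigmaMaxModificationsCorridor3.Helpers

namespace Summit.ResolutionOfSingularities.ResolutionOfSingularities.Theorems.SigmaMaxModificationsCorridor3.Sigma

universe u v

variable {K : Type v} [Field K]

namespace ContactChart

variable {W W' : Scheme.{u}} {φ : K →+* Γ(W, ⊤)} {τ : W' ⟶ W} {C N : W.IdealSheafData} {S₀ : ℕ}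

/-- [OURS · L1 W4.2] **«𝓑 ∪ H SNC ON THE CHART»**: the contact ideal sheaf `H` of the chart, prepended to the boundary `E` restricted to the chart's open
subscheme, is a simple-normal-crossings list (`HasSNC`). NOT a statement of the manuscript. [folklore] -/
def SncWith (ch : ContactChart φ N S₀) (E : List W.IdealSheafData) : Prop :=
  HasSNC (ch.H :: E.map (·.comap ch.U.ι))

/-- Unfolding. [folklore] -/
theorem sncWith_iff (ch : ContactChart φ N S₀) (E : List W.IdealSheafData) :
    ch.SncWith E ↔ HasSNC (ch.H :: E.map (·.comap ch.U.ι)) := Iff.rfl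

/-- `E = []`: `SncWith []` is `HasSNC [H]`. [folklore] -/
theorem sncWith_nil_iff (ch : ContactChart φ N S₀) : ch.SncWith [] ↔ HasSNC [ch.H] := Iff.rfl

variable [IsLocallyNoetherian W] [IsLocallyNoetherian W']

/-- **BASE of the induction (`𝓑 = ∅`)**: on a regular `W` the chart's hypersurface alone is snc — it is generated at every support point by an element of
order one (`order_one`) on the regular open subscheme (Kollár 3.80 «smooth hypersurface of maximal contact»; tree `hasSNC_singleton_of_generator`).
[cite: Kollar2007, Thm. 3.80 (p. 155)] -/
theorem sncWith_nil (ch : ContactChart φ N S₀) (hW : Scheme.IsRegular W) : ch.SncWith [] :=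
  hasSNC_singleton_of_generator (Scheme.IsRegular.of_isOpenImmersion ch.U.ι hW) ch.order_one

/-- **The contact hypersurface contains the restricted centre**: `H ≤ C|_U` (060's `le_centre_of_diffContact` on the open subscheme). [cite: Kollar2007, Thm. 3.80 (1) (proof)] -/
theorem le_centre (ch : ContactChart φ N S₀) (hUs : HasFiniteTypeSections (ch.U.ι.appTop.hom.comp φ)) (hW : Scheme.IsRegular W)
    (hC : Scheme.IsRegular C.subscheme) (hS : 1 ≤ S₀) (hsupp : ∀ y ∈ C.support, (S₀ : ℕ∞) ≤ idealOrder N y) : ch.H ≤ C.comap ch.U.ι :=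
  le_centre_of_diffContact hUs (Scheme.IsRegular.of_isOpenImmersion ch.U.ι hW) (Scheme.IsRegular.subscheme_comap_of_isOpenImmersion ch.U.ι hC)
    (N.comap ch.U.ι) hS (forall_mem_support_comap_le_idealOrder hsupp ch.U) ch.le_diff

/-- **THE LIFT (tri-1 (B); Kollár 3.104 Step 2.1)**: a 𝓑-permissible centre (`HasSNCWith E C`: regular, snc with the boundary) whose support lies in the
order-`≥ S₀` locus is snc with `H :: 𝓑|_U` on a chart where `𝓑 ∪ H` is snc — because `H ≤ C|_U` (`le_centre`) and the parameter exchange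
`HasSNCWith.cons_of_le`. [cite: Kollar2007, 3.104 Step 2.1 (p. 172)] -/
theorem hasSNCWith_cons (ch : ContactChart φ N S₀) (E : List W.IdealSheafData) (hUs : HasFiniteTypeSections (ch.U.ι.appTop.hom.comp φ))
    (hW : Scheme.IsRegular W) (hC : Scheme.IsRegular C.subscheme) (hS : 1 ≤ S₀) (hsupp : ∀ y ∈ C.support, (S₀ : ℕ∞) ≤ idealOrder N y)
    (hE : HasSNCWith E C) (hHE : ch.SncWith E) : HasSNCWith (ch.H :: E.map (·.comap ch.U.ι)) (C.comap ch.U.ι) :=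
  (hE.comap_of_isOpenImmersion ch.U.ι).cons_of_le hHE (ch.le_centre hUs hW hC hS hsupp)

/-- **The strict transform of the chart's hypersurface IS the transported chart's `H′`** (`= (τ∣_U)ᶜ(H, 1)`; Kollár 3.30.2 for the regular order-one
hypersurface through the regular centre). [cite: Kollar2007, 3.30.2] -/
theorem strictTransformIdeal_H_eq (ch : ContactChart φ N S₀) (hUs : HasFiniteTypeSections (ch.U.ι.appTop.hom.comp φ))
    (hU's : HasFiniteTypeSections ((τ ∣_ ch.U).appTop.hom.comp (ch.U.ι.appTop.hom.comp φ))) (hτ : IsBlowup τ C) (hW : Scheme.IsRegular W)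
    (hC : Scheme.IsRegular C.subscheme) (hS : 1 ≤ S₀) (hsupp : ∀ y ∈ C.support, (S₀ : ℕ∞) ≤ idealOrder N y) :
    strictTransformIdeal (τ ∣_ ch.U) (C.comap ch.U.ι) ch.H = (ch.transform hUs hU's hτ hW hC hS hsupp).H :=
  IsBlowup.strictTransformIdeal_eq_controlledTransform_of_hypersurface (Scheme.IsRegular.of_isOpenImmersion ch.U.ι hW)
    (IsBlowup.morphismRestrict τ ch.U hτ) (Scheme.IsRegular.subscheme_comap_of_isOpenImmersion ch.U.ι hC) (ch.le_centre hUs hW hC hS hsupp) ch.order_one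

/-- The step law from the LIFTED hypothesis: if the restricted centre has simple normal crossings with the chart's `H :: 𝓑|_U`, then after the blow-up the
transported chart's `H′` together with the transformed boundary of record (strict transforms of the members, then the exceptional divisor) restricted to `τ⁻¹(U)`
has simple normal crossings. [cite: Kollar2007, Def. 3.25] [cite: BierstoneGrigorievMilmanWlodarczyk2011, Def. 3.1.3 (2), (4)] -/
theorem sncWith_transform_of_hasSNCWith (ch : ContactChart φ N S₀) (E : List W.IdealSheafData) (hUs : HasFiniteTypeSections (ch.U.ι.appTop.hom.comp φ))
    (hU's : HasFiniteTypeSections ((τ ∣_ ch.U).appTop.hom.comp (ch.U.ι.appTop.hom.comp φ))) (hτ : IsBlowup τ C) (hW : Scheme.IsRegular W)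
    (hC : Scheme.IsRegular C.subscheme) (hS : 1 ≤ S₀) (hsupp : ∀ y ∈ C.support, (S₀ : ℕ∞) ≤ idealOrder N y)
    (hsnc : HasSNCWith (ch.H :: E.map (·.comap ch.U.ι)) (C.comap ch.U.ι)) :
    (ch.transform hUs hU's hτ hW hC hS hsupp).SncWith (E.map (strictTransformIdeal τ C) ++ [C.comap τ]) := by
  have h := hsnc.hasSNC_transform (IsBlowup.morphismRestrict τ ch.U hτ)
  rw [List.map_cons, ch.strictTransformIdeal_H_eq hUs hU's hτ hW hC hS hsupp, List.cons_append, transformBoundary_morphismRestrict] at h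
  exact h

/-- [OURS · L1 W4.2] **THE STEP LAW «𝓑 ∪ H snc persists along the run»** (tri-1's induction (B), typed AND proved): if `𝓑 ∪ H` is snc on the chart and the
centre is 𝓑-permissible (`HasSNCWith E C`) inside the order-`≥ S₀` locus, then after the blow-up the transported chart's `H′` together with the transformed
boundary `E.map (strictTransformIdeal τ C) ++ [C.comap τ]` is snc on `τ⁻¹(U)`. [cite: Kollar2007, 3.104 Step 2.1 (p. 172); Def. 3.25] -/
theorem sncWith_transform (ch : ContactChart φ N S₀) (E : List W.IdealSheafData) (hUs : HasFiniteTypeSections (ch.U.ι.appTop.hom.comp φ))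
    (hU's : HasFiniteTypeSections ((τ ∣_ ch.U).appTop.hom.comp (ch.U.ι.appTop.hom.comp φ))) (hτ : IsBlowup τ C) (hW : Scheme.IsRegular W)
    (hC : Scheme.IsRegular C.subscheme) (hS : 1 ≤ S₀) (hsupp : ∀ y ∈ C.support, (S₀ : ℕ∞) ≤ idealOrder N y)
    (hE : HasSNCWith E C) (hHE : ch.SncWith E) :
    (ch.transform hUs hU's hτ hW hC hS hsupp).SncWith (E.map (strictTransformIdeal τ C) ++ [C.comap τ]) :=
  ch.sncWith_transform_of_hasSNCWith E hUs hU's hτ hW hC hS hsupp (ch.hasSNCWith_cons E hUs hW hC hS hsupp hE hHE)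

/-! ### Restriction to `V(H) ∩ U` (tri-1's ask 21:01:08Z: Cutkosky Def. 5.4 «E a SNC divisor on V» for the datum `(∅, 𝓑|_V, J, V)`) -/

/-- **`V(H) ∩ U` is regular** (the chart's hypersurface is snc alone, hence a regular centre). [cite: Kollar2007, Thm. 3.80 (p. 155)] -/
theorem isRegular_subscheme_H (ch : ContactChart φ N S₀) (hW : Scheme.IsRegular W) : Scheme.IsRegular ch.H.subscheme := by
  have h1 : HasSNC [ch.H] := ch.sncWith_nil hW
  have h2 : HasSNCWith [ch.H] ch.H := by
    intro x
    obtain ⟨hreg, u, hu, ⟨ι, hιinj, hιu⟩, -⟩ := h1 x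
    refine ⟨hreg, u, hu, ⟨ι, hιinj, hιu⟩, fun hx => ⟨{ι ⟨ch.H, List.mem_cons_self, hx⟩}, ?_⟩⟩
    rw [Set.image_singleton]
    exact hιu ⟨ch.H, List.mem_cons_self, hx⟩
  exact h2.isRegular_subscheme

omit [IsLocallyNoetherian W] in
/-- **RESTRICTION READING**: if `𝓑 ∪ H` is snc on the chart, the traces `(B ∩ V(H))_{B ∈ 𝓑}` (members of `𝓑|_U` equal to `H` discarded) form an snc list on
the closed subscheme `V(H) ∩ U` (BGMW Lemma 3.9.4 (1), tree `hasSNC_filter_map_comap_subschemeι`). [cite: BierstoneGrigorievMilmanWlodarczyk2011, Lemma 3.9.4 (1)] -/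
theorem hasSNC_traces_of_sncWith (ch : ContactChart φ N S₀) (E : List W.IdealSheafData) [DecidableEq (ch.U : Scheme.{u}).IdealSheafData]
    (h : ch.SncWith E) : HasSNC (((E.map (·.comap ch.U.ι)).filter fun D => D ≠ ch.H).map fun D => D.comap ch.H.subschemeι) :=
  hasSNC_filter_map_comap_subschemeι ch.H _ ((ch.sncWith_iff E).mp h)

omit [IsLocallyNoetherian W] in
/-- The same without the filter when no boundary member coincides with `H` on the chart. [cite: BierstoneGrigorievMilmanWlodarczyk2011, Lemma 3.9.4 (1)] -/
theorem hasSNC_traces_of_sncWith_of_ne (ch : ContactChart φ N S₀) (E : List W.IdealSheafData) (hne : ∀ B ∈ E, B.comap ch.U.ι ≠ ch.H)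
    (h : ch.SncWith E) : HasSNC ((E.map (·.comap ch.U.ι)).map fun D => D.comap ch.H.subschemeι) := by
  classical
  have h' := ch.hasSNC_traces_of_sncWith E h
  rwa [List.filter_eq_self.mpr] at h'
  intro D hD
  obtain ⟨B, hB, rfl⟩ := List.mem_map.mp hD
  simpa using hne B hB

end ContactChart

namespace ContactCover

variable {W W' : Scheme.{u}} {φ : K →+* Γ(W, ⊤)} {τ : W' ⟶ W} {C N : W.IdealSheafData} {S₀ : ℕ}

/-- [OURS · L1 W4.2] **A COVER is snc with the boundary** when every chart is. NOT a statement of the manuscript. [folklore] -/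
def SncWith (cov : ContactCover φ N S₀) (E : List W.IdealSheafData) : Prop :=
  ∀ i, (cov.chart i).SncWith E

variable [IsLocallyNoetherian W] [IsLocallyNoetherian W']

/-- BASE at cover level: every cover is snc with the empty boundary on a regular `W`. [cite: Kollar2007, Thm. 3.80 (p. 155)] -/
theorem sncWith_nil (cov : ContactCover φ N S₀) (hW : Scheme.IsRegular W) : cov.SncWith [] :=
  fun i => (cov.chart i).sncWith_nil hW

/-- **The cover-level step law**: chartwise `ContactChart.sncWith_transform`. [cite: Kollar2007, 3.104 Step 2.1 (p. 172); Def. 3.25] -/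
theorem sncWith_transform (cov : ContactCover φ N S₀) (E : List W.IdealSheafData) (hWs : ∀ U : W.Opens, HasFiniteTypeSections (U.ι.appTop.hom.comp φ))
    (hW's : ∀ U : W.Opens, HasFiniteTypeSections ((τ ∣_ U).appTop.hom.comp (U.ι.appTop.hom.comp φ))) (hτ : IsBlowup τ C)
    (hW : Scheme.IsRegular W) (hC : Scheme.IsRegular C.subscheme) (hS : 1 ≤ S₀) (hsupp : ∀ y ∈ C.support, (S₀ : ℕ∞) ≤ idealOrder N y)
    (hE : HasSNCWith E C) (hHE : cov.SncWith E) :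
    (cov.transform hWs hW's hτ hW hC hS hsupp).SncWith (E.map (strictTransformIdeal τ C) ++ [C.comap τ]) :=
  fun i => (cov.chart i).sncWith_transform E (hWs _) (hW's _) hτ hW hC hS hsupp hE (hHE i)

end ContactCover

end Summit.ResolutionOfSingularities.ResolutionOfSingularities.Theorems.SigmaMaxModificationsCorridor3.Sigma

end
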